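import Literature.NumberTheory.Automorphic.BrandtModuleSplitLocal
import Literature.NumberTheory.Automorphic.BrandtModuleResidueBasic
import HarnessLib

/-!
# Residually ramified primes I: the prime `𝔓`, its invertibility and the norm valuation

Eighteenth layer of the proof files for the named fact `brandtMatrix_comm` of `BrandtModule.lean`
(Vignéras, LNM 800, III §5 ex. 5.8 (c); Eichler 1973, II §6 Thm. 2). For a `ℤ`-order `O`
residually ramified at `p`, with the two-sided lattice `𝔓` of `IsResiduallyRamified` (exposed
as `IsRamifiedData O 𝔓 p`: `p O ⊆ 𝔓 ⊆ O`, `𝔓² = p O`, `[O : 𝔓] = p²`, `O / 𝔓` a division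
ring), in a division quaternion algebra over `ℚ`:

* `IsRamifiedData.dvd_trdZ_nrdZ_of_mem` — elements of `𝔓` have `p ∣ trd`, `p ∣ nrd`;
* `IsRamifiedData.isInvertibleRightIdeal` — `𝔓` is an invertible right `O`-ideal (inverse
  `p⁻¹ 𝔓`), hence locally principal: `𝔓_(p) = π O_(p)` (`QuaternionIdealLocallyPrincipal`);
* `IsRamifiedData.padicValRat_reducedNorm_eq_zero` — a unit `z ∈ O_(p) ∖ 𝔓_(p)` has
  `v_p(nrd z) = 0` (`z w ≡ 1 (mod 𝔓)` up to a prime-to-`p` scalar, and `nrd(1 + π₁) ≡ 1`);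
* `IsRamifiedData.exists_uniformizer` — a `π ∈ 𝔓` with `𝔓_(p) = π O_(p)` and `v_p(nrd π) = 1`.

## References

* M.-F. Vignéras, LNM 800 (1980), Ch. II §1 Thm. 1.1, Lemme 1.5 (`P = Oπ`, `w = v ∘ n`) [VignerasLNM800].
* J. Voight, *Quaternion Algebras* (2021), §13.3, Main Thm. 16.6.1 [Voight2021].
-/

noncomputable section

open scoped Pointwise

universe u

namespace Literature.NumberTheory.Automorphic

variable {B : Type u} [Ring B] [Algebra ℚ B] [IsQuaternionAlgebra ℚ B] {O P : Submodule ℤ B} {p : ℕ}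

/-! ### The data of a residually ramified prime -/

/-- **The prime `𝔓` of a residually ramified order**: the data of `IsResiduallyRamified` with the
witness exposed. [cite: VignerasLNM800, Ch. II §1 Thm. 1.1, Lemme 1.5] -/
structure IsRamifiedData (O P : Submodule ℤ B) (p : ℕ) : Prop where
  /-- `p O ⊆ 𝔓`. -/
  smul_le : (p : ℤ) • O ≤ P
  /-- `𝔓 ⊆ O`. -/
  le : P ≤ O
  /-- `O 𝔓 ⊆ 𝔓`. -/
  mul_le_left : O * P ≤ P
  /-- `𝔓 O ⊆ 𝔓`. -/
  mul_le_right : P * O ≤ P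
  /-- `𝔓² = p O`. -/
  mul_self : P * P = (p : ℤ) • O
  /-- `[O : 𝔓] = p²`. -/
  relIndex_eq : P.toAddSubgroup.relIndex O.toAddSubgroup = p ^ 2
  /-- `O / 𝔓` is a division ring. -/
  div : ∀ x ∈ O, x ∉ P → ∃ w ∈ O, x * w - 1 ∈ P ∧ w * x - 1 ∈ P

omit [Algebra ℚ B] [IsQuaternionAlgebra ℚ B] in
/-- A residually ramified order has ramified data. [folklore] -/
theorem IsZOrder.IsResiduallyRamified.exists_isRamifiedData {hO : IsZOrder O} (h : hO.IsResiduallyRamified p) :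
    ∃ P : Submodule ℤ B, IsRamifiedData O P p := by
  obtain ⟨P, h1, h2, h3, h4, h5, h6, h7⟩ := h
  exact ⟨P, ⟨h1, h2, h3, h4, h5, h6, h7⟩⟩

namespace IsRamifiedData

variable (hO : IsZOrder O) (hP : IsRamifiedData O P p) (hp : p.Prime)
include hP

omit [Algebra ℚ B] [IsQuaternionAlgebra ℚ B] in
/-- `o x ∈ 𝔓` and `x o ∈ 𝔓` for `o ∈ O`, `x ∈ 𝔓`. [folklore] -/
theorem mul_mem {o x : B} (ho : o ∈ O) (hx : x ∈ P) : o * x ∈ P ∧ x * o ∈ P :=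
  ⟨(Submodule.mul_le.mp hP.mul_le_left) o ho x hx, (Submodule.mul_le.mp hP.mul_le_right) x hx o ho⟩

include hp in
omit [Algebra ℚ B] [IsQuaternionAlgebra ℚ B] in
/-- `1 ∉ 𝔓`. [folklore] -/
theorem one_not_mem : (1 : B) ∉ P := fun h => by
  have hOP : O ≤ P := fun o ho => by simpa using (hP.mul_mem ho h).1
  have := AddSubgroup.relIndex_eq_one.mpr (Submodule.toAddSubgroup_mono hOP)
  rw [hP.relIndex_eq] at this
  exact absurd this (by have := Nat.one_lt_pow two_ne_zero hp.one_lt; omega)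

include hp in
omit [Algebra ℚ B] [IsQuaternionAlgebra ℚ B] in
/-- `k · 1 ∈ 𝔓` forces `p ∣ k`. [folklore] -/
theorem dvd_of_zsmul_one_mem (h1 : (1 : B) ∈ O) {k : ℤ} (hk : k • (1 : B) ∈ P) : (p : ℤ) ∣ k := by
  by_contra hnd
  obtain ⟨a, b, hab⟩ := IsZOrder.isCoprime_natCast_of_not_dvd hp hnd
  apply hP.one_not_mem hp
  have : (1 : B) = a • ((p : ℤ) • (1 : B)) + b • (k • (1 : B)) := by
    rw [smul_smul, smul_smul, ← add_smul, hab, one_smul]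
  rw [this]
  exact P.add_mem (P.smul_mem _ (hP.smul_le (Submodule.smul_mem_pointwise_smul _ _ O h1))) (P.smul_mem _ hk)

include hO hp in
/-- **Elements of `𝔓` have `p ∣ trd` and `p ∣ nrd`**: in `A = O / p O` the residue `a` of
`x ∈ 𝔓` has `a² = 0` (as `𝔓² = p O`), so `t a = n`; if `p ∤ t` then `a = t⁻¹ n` is a scalar
congruent to `x` modulo `p O ⊆ 𝔓`, forcing `p ∣ t⁻¹ n`, `a = 0`, `x ∈ p O` and `p ∣ t` after
all; then `n = t a − a² ≡ 0`. [cite: VignerasLNM800, Ch. II §1 Lemme 1.5] -/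
theorem dvd_trdZ_nrdZ_of_mem {x : B} (hx : x ∈ P) : (p : ℤ) ∣ trdZ x ∧ (p : ℤ) ∣ nrdZ x := by
  have hxO : x ∈ O := hP.le hx
  set xs : hO.subring := ⟨x, hxO⟩ with hxs
  have hsq : hO.res p xs * hO.res p xs = 0 := by
    rw [← map_mul, IsZOrder.res_eq_zero_iff, Subring.coe_mul, ← hP.mul_self]
    exact Submodule.mul_mem_mul hx hx
  have hrel := hO.res_mul_res (p := p) xs
  rw [hsq] at hrel
  -- `t a = n` in `A`
  have hta : (trdZ x : hO.Residue p) * hO.res p xs = (nrdZ x : hO.Residue p) := (sub_eq_zero.mp hrel.symm)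
  have ht : (p : ℤ) ∣ trdZ x := by
    by_contra hnd
    obtain ⟨l, hl⟩ := hO.exists_intCast_mul_eq_one hp hnd
    have hres : hO.res p xs = hO.res p ((l * nrdZ x : ℤ) : hO.subring) := by
      rw [map_intCast, Int.cast_mul, ← hta, ← mul_assoc, hl, one_mul]
    have hdiff : x - ((l * nrdZ x : ℤ) : B) ∈ (p : ℤ) • O := by
      have := IsZOrder.res_eq_res_iff.mp hres
      simpa only [hxs, Subring.coe_intCast] using this
    have hk : (l * nrdZ x) • (1 : B) ∈ P := by
      have : (l * nrdZ x) • (1 : B) = x - (x - ((l * nrdZ x : ℤ) : B)) := by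
        rw [zsmul_eq_mul, mul_one, sub_sub_cancel]
      rw [this]
      exact P.sub_mem hx (hP.smul_le hdiff)
    have hpk : (p : ℤ) ∣ l * nrdZ x := hP.dvd_of_zsmul_one_mem hp hO.one_mem hk
    have h0 : hO.res p xs = 0 := by
      rw [hres, map_intCast, hO.intCast_residue_eq_zero_iff hp]
      exact hpk
    obtain ⟨o, ho, hxo⟩ := (Submodule.mem_smul_pointwise_iff_exists _ _ O).mp (IsZOrder.res_eq_zero_iff.mp h0)
    apply hnd
    change (p : ℤ) • o = x at hxo
    rw [← hxo, hO.trdZ_zsmul _ ho]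
    exact dvd_mul_right _ _
  refine ⟨ht, ?_⟩
  rw [(hO.intCast_residue_eq_zero_iff hp).mpr ht, zero_mul] at hta
  exact (hO.intCast_residue_eq_zero_iff hp).mp hta.symm

/-! ### `𝔓` is an invertible right `O`-ideal -/

omit [Algebra ℚ B] [IsQuaternionAlgebra ℚ B] hP in
/-- `(𝔓 𝔓) x ⊆ 𝔓 𝔓` whenever `𝔓 x ⊆ 𝔓`, and symmetrically. [folklore] -/
theorem mul_self_mul_mem {x : B} (hx : ∀ y ∈ P, y * x ∈ P) {y : B} (hy : y ∈ P * P) : y * x ∈ P * P := by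
  refine Submodule.mul_induction_on hy (fun a ha b hb => ?_) (fun a b ha hb => ?_)
  · rw [mul_assoc]; exact Submodule.mul_mem_mul ha (hx b hb)
  · rw [add_mul]; exact Submodule.add_mem _ ha hb

omit [Algebra ℚ B] [IsQuaternionAlgebra ℚ B] hP in
/-- `x (𝔓 𝔓) ⊆ 𝔓 𝔓` whenever `x 𝔓 ⊆ 𝔓`. [folklore] -/
theorem mul_mul_self_mem {x : B} (hx : ∀ y ∈ P, x * y ∈ P) {y : B} (hy : y ∈ P * P) : x * y ∈ P * P := by
  refine Submodule.mul_induction_on hy (fun a ha b hb => ?_) (fun a b ha hb => ?_)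
  · rw [← mul_assoc]; exact Submodule.mul_mem_mul (hx a ha) hb
  · rw [mul_add]; exact Submodule.add_mem _ ha hb

include hO hp in
omit [IsQuaternionAlgebra ℚ B] in
/-- **`O_r(𝔓) = O`**: if `𝔓 x ⊆ 𝔓` then `p O x = 𝔓² x ⊆ 𝔓² = p O`, so `p x ∈ p O` and `x ∈ O`. [folklore] -/
theorem rightOrderOf_eq : rightOrderOf P = O := by
  haveI : IsAddTorsionFree B := isAddTorsionFree_of_charZero_module ℚ B
  refine le_antisymm (fun x hx => ?_) (fun o ho y hy => (hP.mul_mem ho hy).2)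
  have hp1 : (p : ℤ) • (1 : B) ∈ P * P := by
    rw [hP.mul_self]; exact Submodule.smul_mem_pointwise_smul _ _ O hO.one_mem
  have h := mul_self_mul_mem hx hp1
  rw [hP.mul_self, smul_mul_assoc, one_mul] at h
  have := IsZOrder.mem_smul_of_smul_mem_smul O (m := (p : ℤ)) (n := 1) (by exact_mod_cast hp.ne_zero)
    (by rwa [mul_one])
  rwa [one_smul] at this

include hO hp in
omit [IsQuaternionAlgebra ℚ B] in
/-- **`O_l(𝔓) = O`**, symmetrically. [folklore] -/
theorem leftOrderOf_eq : leftOrderOf P = O := by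
  haveI : IsAddTorsionFree B := isAddTorsionFree_of_charZero_module ℚ B
  refine le_antisymm (fun x hx => ?_) (fun o ho y hy => (hP.mul_mem ho hy).1)
  have hp1 : (p : ℤ) • (1 : B) ∈ P * P := by
    rw [hP.mul_self]; exact Submodule.smul_mem_pointwise_smul _ _ O hO.one_mem
  have h := mul_mul_self_mem hx hp1
  rw [hP.mul_self, mul_smul_comm, mul_one] at h
  have := IsZOrder.mem_smul_of_smul_mem_smul O (m := (p : ℤ)) (n := 1) (by exact_mod_cast hp.ne_zero)
    (by rwa [mul_one])
  rwa [one_smul] at this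

omit [Algebra ℚ B] [IsQuaternionAlgebra ℚ B] hP in
/-- For a central unit `w`: `M (w • N) = w • (M N)`. [folklore] -/
theorem mul_units_smul_of_central {w : Bˣ} (hw : ∀ x : B, (w : B) * x = x * w) (M N : Submodule ℤ B) :
    M * (w • N) = w • (M * N) := by
  refine le_antisymm (Submodule.mul_le.mpr fun a ha b hb => ?_) fun x hx => ?_
  · obtain ⟨n, hn, rfl⟩ := (Submodule.mem_smul_pointwise_iff_exists _ _ N).mp hb
    refine (Submodule.mem_smul_pointwise_iff_exists _ _ _).mpr ⟨a * n, Submodule.mul_mem_mul ha hn, ?_⟩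
    rw [Units.smul_def, Units.smul_def, smul_eq_mul, smul_eq_mul, ← mul_assoc, hw a, mul_assoc]
  · obtain ⟨y, hy, rfl⟩ := (Submodule.mem_smul_pointwise_iff_exists _ _ _).mp hx
    refine Submodule.mul_induction_on hy (fun a ha b hb => ?_) (fun a b ha hb => ?_)
    · have : w • (a * b) = a * (w • b) := by
        rw [Units.smul_def, Units.smul_def, smul_eq_mul, smul_eq_mul, ← mul_assoc, hw a, mul_assoc]
      rw [this]
      exact Submodule.mul_mem_mul ha (Submodule.smul_mem_pointwise_smul _ _ N hb)
    · rw [smul_add]; exact Submodule.add_mem _ ha hb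

omit [Algebra ℚ B] [IsQuaternionAlgebra ℚ B] hP in
/-- For a central unit `w`: `(w • M) N = w • (M N)`. [folklore] -/
theorem units_smul_mul_of_central {w : Bˣ} (M N : Submodule ℤ B) :
    (w • M) * N = w • (M * N) := by
  refine le_antisymm (Submodule.mul_le.mpr fun a ha b hb => ?_) fun x hx => ?_
  · obtain ⟨m, hm, rfl⟩ := (Submodule.mem_smul_pointwise_iff_exists _ _ M).mp ha
    refine (Submodule.mem_smul_pointwise_iff_exists _ _ _).mpr ⟨m * b, Submodule.mul_mem_mul hm hb, ?_⟩
    rw [Units.smul_def, Units.smul_def, smul_eq_mul, smul_eq_mul, mul_assoc]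
  · obtain ⟨y, hy, rfl⟩ := (Submodule.mem_smul_pointwise_iff_exists _ _ _).mp hx
    refine Submodule.mul_induction_on hy (fun a ha b hb => ?_) (fun a b ha hb => ?_)
    · have : w • (a * b) = (w • a) * b := by
        rw [Units.smul_def, Units.smul_def, smul_eq_mul, smul_eq_mul, mul_assoc]
      rw [this]
      exact Submodule.mul_mem_mul (Submodule.smul_mem_pointwise_smul _ _ M ha) hb
    · rw [smul_add]; exact Submodule.add_mem _ ha hb

include hO hp in
omit [IsQuaternionAlgebra ℚ B] in
/-- **`𝔓` is an invertible right `O`-ideal**, with inverse `p⁻¹ 𝔓`. [cite: VignerasLNM800, Ch. II §1 Thm. 1.1 (P idéal bilatère, P² = pO)] -/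
theorem isInvertibleRightIdeal : IsInvertibleRightIdeal O P := by
  obtain ⟨w, hw⟩ := exists_units_eq_natCast (B := B) hp.ne_zero
  have hwc : ∀ x : B, (w : B) * x = x * w := fun x => by rw [hw]; exact (Nat.cast_commute p x).eq
  have hwc' : ∀ x : B, ((w⁻¹ : Bˣ) : B) * x = x * (w⁻¹ : Bˣ) := fun x =>
    calc ((w⁻¹ : Bˣ) : B) * x = (w⁻¹ : Bˣ) * x * ((w : B) * (w⁻¹ : Bˣ)) := by rw [Units.mul_inv, mul_one]
      _ = (w⁻¹ : Bˣ) * ((w : B) * x) * (w⁻¹ : Bˣ) := by rw [hwc x]; simp only [mul_assoc]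
      _ = x * (w⁻¹ : Bˣ) := by rw [← mul_assoc, Units.inv_mul, one_mul]
  have hPP : P * P = w • O := by rw [hP.mul_self, units_smul_eq_natCast_smul hw]
  refine ⟨isFullLattice_of_between hO.isFullLattice hP.le (by exact_mod_cast hp.ne_zero : (p : ℤ) ≠ 0)
      fun x hx => hP.smul_le (Submodule.smul_mem_pointwise_smul _ _ O hx),
    hP.rightOrderOf_eq hO hp, ⟨w⁻¹ • P, ?_, ?_⟩⟩
  · rw [hP.leftOrderOf_eq hO hp, mul_units_smul_of_central hwc', hPP, inv_smul_smul]
  · rw [units_smul_mul_of_central, hPP, inv_smul_smul]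

/-! ### The norm valuation off `𝔓` and a uniformizer -/

include hO hp in
/-- **A unit `z ∈ O_(p) ∖ 𝔓_(p)` has `v_p(nrd z) = 0`**: with `c z ∈ O ∖ 𝔓` (`c` prime to `p`)
and `(c z) w = 1 + π₁`, `π₁ ∈ 𝔓`, one has `nrd(1 + π₁) = 1 + trd π₁ + nrd π₁ ≡ 1 (mod p)`, so
`p ∤ nrd(c z)`. [cite: VignerasLNM800, Ch. II §1 Lemme 1.4–1.5] -/
theorem padicValRat_reducedNorm_eq_zero [Fact p.Prime] {z : Bˣ} (hz : (z : B) ∈ localAt p O)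
    (hzP : (z : B) ∉ localAt p P) : padicValRat p (reducedNorm ℚ B z) = 0 := by
  obtain ⟨c, hc0, hcop, hcz⟩ := mem_localAt_iff.mp hz
  set x : B := (c : ℤ) • (z : B) with hxdef
  have hxO : x ∈ O := hcz
  have hxP : x ∉ P := fun h => hzP (mem_localAt_iff.mpr ⟨c, hc0, hcop, h⟩)
  obtain ⟨w, hw, h1, -⟩ := hP.div x hxO hxP
  set π₁ : B := x * w - 1 with hπ₁
  have hπ₁O : π₁ ∈ O := hP.le h1
  obtain ⟨ht, hn⟩ := hP.dvd_trdZ_nrdZ_of_mem hO hp h1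
  have hxw : x * w = 1 + π₁ := by rw [hπ₁]; abel
  have hnrd : nrdZ (x * w) = 1 + trdZ π₁ + nrdZ π₁ := by
    rw [hxw, hO.nrdZ_add hO.one_mem hπ₁O, IsZOrder.nrdZ_one, IsZOrder.polZ, IsZOrder.trdZ_one, one_mul]
    ring
  have hndvd : ¬ (p : ℤ) ∣ nrdZ x := by
    intro h
    have h' : (p : ℤ) ∣ nrdZ (x * w) := by rw [hO.nrdZ_mul hxO hw]; exact h.mul_right _
    rw [hnrd] at h'
    have h1' : (p : ℤ) ∣ 1 := by
      have := dvd_sub (dvd_sub h' hn) ht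
      rwa [add_sub_cancel_right, add_sub_cancel_right] at this
    exact hp.one_lt.ne' (by exact_mod_cast Int.eq_one_of_dvd_one (by positivity) h1')
  have hvx : padicValRat p (reducedNorm ℚ B x) = 0 := by
    rw [← hO.cast_nrdZ hxO, padicValRat.of_int, padicValInt.eq_zero_of_not_dvd hndvd, Nat.cast_zero]
  have hz0 : reducedNorm ℚ B (z : B) ≠ 0 := (isUnit_iff_reducedNorm_ne_zero_holds ℚ B (z : B)).mp z.isUnit
  have hxz : reducedNorm ℚ B x = (c : ℚ) ^ 2 * reducedNorm ℚ B z := by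
    rw [hxdef, natCast_zsmul_eq_ratCast_smul, reducedNorm_smul]
  rw [hxz, padicValRat.mul (pow_ne_zero 2 (by exact_mod_cast hc0)) hz0,
    show ((c : ℚ)) ^ 2 = ((c ^ 2 : ℕ) : ℚ) by push_cast; ring,
    padicValRat_natCast_eq_zero_of_coprime (Nat.Coprime.pow_left 2 hcop), zero_add] at hvx
  exact hvx

include hO hp in
/-- **A uniformizer**: `π ∈ 𝔓` with `𝔓_(p) = π O_(p)` and `v_p(nrd π) = 1`
(`[O_(p) : π O_(p)] = [O : 𝔓] = p²`). [cite: VignerasLNM800, Ch. II §1 Thm. 1.1 (P = Oπ)] -/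
theorem exists_uniformizer [Fact p.Prime] (hdiv : ∀ x : B, x ≠ 0 → IsUnit x) :
    ∃ π : Bˣ, (π : B) ∈ P ∧ localAt p P = π • localAt p O ∧ padicValRat p (reducedNorm ℚ B π) = 1 := by
  obtain ⟨π, hπP, hπ⟩ := (hP.isInvertibleRightIdeal hO hp).exists_localAt_eq_units_smul hdiv hO p
  refine ⟨π, hπP, hπ, ?_⟩
  have hπO : (π : B) ∈ localAt p O := le_localAt p O (hP.le hπP)
  obtain ⟨k, hk, hidx⟩ := exists_relIndex_units_smul_localAt_eq_pow hO π hπO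
  have hne : P.toAddSubgroup.relIndex O.toAddSubgroup ≠ 0 := by rw [hP.relIndex_eq]; exact pow_ne_zero 2 hp.ne_zero
  have hloc := relIndex_localAt (p := p) O P hP.le hne
  rw [hπ, hidx, hP.relIndex_eq, Nat.Prime.factorization_pow hp, Finsupp.single_eq_same] at hloc
  have : k = 1 := by
    have := Nat.pow_right_injective hp.two_le hloc
    omega
  rw [hk, this, Nat.cast_one]

end IsRamifiedData

end Literature.NumberTheory.Automorphic

end
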